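import Summits.ABC.IUTFork.Repair.RHHullThresholdExact
import HarnessLib

/-!
# HEX `k = 10` and `k = 12`: the top-label hull cell at `p = 7` FAILS on the MIDDLE ranges `481 ≤ l ≤ 881` (`k = 10`, member `A = 3`) and
# `481 ≤ l ≤ 3361` (`k = 12`, member `A = 5`) — the integer side of the M-line REF glue between the low range and the `…_band` twins
# (row «W:REF-EXACT-M-TWIN», HEX part)

PROOF-ONLY file (D-0012; 0 definitions, 0 `Prop` facts, no instance) of the abc-iut cell — D-0079 RESCUE sub-cell R-W «WINDOW Θ-SIDE INEQUALITY», seat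
abc-iut-W-neg-1 (gen 6). PURE ARITHMETIC in the byte shape of abc-iut-C-cert-1's `RefBand.not_hullCell_hex<k>_A<A>_a<a₀>` / `RefBand.cells_hex<k>_band`
(`WRowHexLamSeven<K>RefutedCells`). On the K line these two ranges are abc-iut-rh-typ-4's pinned-type hull-cell theorems
`HexHullThreshold.not_pilotKummerCompatHull_lamSeven_ten_band` (`319 … 881`) and `…_twelve_band` / `…_twelve_band_high` (`481 … 3361`), which the K glue
theorems `GenuineK.not_pilotKummerCompatHull_chosen_lamSeven_ten_le` / `…_twelve_le` cite BY NAME and which have no M twin; the M-line hull-cell engine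
(this seat's `GenuineM.not_pilotKummerCompatHull_triple_of_hullCells_tameSharp`, p528325) needs only the failing cells (desk: exact integers, every odd `l`,
floor-free margin positive): `RefBand.not_hullCell_hex10mid_A3_a3` / `…_a4`, **`RefBand.cells_hex10_mid`** (`481 ≤ l ≤ 881`); `RefBand.not_hullCell_hex12mid_A5_a4` /
`…_a5`, **`RefBand.cells_hex12_mid`** (`481 ≤ l ≤ 3361`). HONEST SCOPE: integer inequalities only; nothing about any datum, (P6), admissibility or
[IUTchIII] Cor. 3.12; no side taken; no abc claim. [cite: Mochizuki2012, IUTchIV Prop. 1.1 p. 9, Prop. 1.2 (i)(ii) p. 10] [cite: DupuyHilado2025, §4.9]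
[claim: Mochizuki2012, status: disputed]
-/

noncomputable section

namespace Summit.ABC.IUTFork.Conditional

open Summit.ABC.IUTFork.Repair.RH.HullThresholdExact

/-! ## HEX `k = 10`: member `A = 3`, `481 ≤ l ≤ 881` -/

/-- Floor-free failure of the top-label cell, `k = 10`, member `A = 3` (`e = 3l`, `m = 30`), turning point `a₀ = 3` (`r_out = 343 − 3·3l`),
every `240 ≤ j ≤ 342` (`l = 2j + 1`), ANY inner radius with `6·r_in ≤ 3l + 6`: downward parabola in `j`, positive on the range. [folklore] -/
theorem RefBand.not_hullCell_hex10mid_A3_a3 {j rin : ℤ} (hlo : 240 ≤ j) (hhi : j ≤ 342) (hrin : 6 * rin ≤ 3 * (2 * j + 1) + 6) :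
    ¬ HullCell (3 * (2 * j + 1)) 30 j rin (343 - 3 * (3 * (2 * j + 1))) := by
  intro hc
  unfold HullCell at hc
  set e : ℤ := 3 * (2 * j + 1) with he
  have he0 : 0 < e := by rw [he]; omega
  set X : ℤ := j ^ 2 * 30 - j * (e - 1) - (j + 1) * rin with hX
  have hdiv : X - e < e * (X / e) := by
    have h1 := Int.emod_add_mul_ediv X e
    have h2 := Int.emod_lt_of_pos X he0
    have h3 := Int.emod_nonneg X he0.ne'
    nlinarith [h1, h2, h3]
  have hk1 : 0 ≤ (342 - j) * (j + 1) := mul_nonneg (by omega) (by omega)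
  have hk2 : 0 ≤ (342 - j) * (j - 240) := mul_nonneg (by omega) (by omega)
  nlinarith [hdiv, hk1, hk2, hc, hrin, hX]

/-- Floor-free failure of the top-label cell, `k = 10`, member `A = 3` (`e = 3l`, `m = 30`), turning point `a₀ = 4` (`r_out = 2401 − 4·3l`),
every `343 ≤ j ≤ 440` (`l = 2j + 1`), ANY inner radius with `6·r_in ≤ 3l + 6`: downward parabola in `j`, positive on the range. [folklore] -/
theorem RefBand.not_hullCell_hex10mid_A3_a4 {j rin : ℤ} (hlo : 343 ≤ j) (hhi : j ≤ 440) (hrin : 6 * rin ≤ 3 * (2 * j + 1) + 6) :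
    ¬ HullCell (3 * (2 * j + 1)) 30 j rin (2401 - 4 * (3 * (2 * j + 1))) := by
  intro hc
  unfold HullCell at hc
  set e : ℤ := 3 * (2 * j + 1) with he
  have he0 : 0 < e := by rw [he]; omega
  set X : ℤ := j ^ 2 * 30 - j * (e - 1) - (j + 1) * rin with hX
  have hdiv : X - e < e * (X / e) := by
    have h1 := Int.emod_add_mul_ediv X e
    have h2 := Int.emod_lt_of_pos X he0
    have h3 := Int.emod_nonneg X he0.ne'
    nlinarith [h1, h2, h3]
  have hk1 : 0 ≤ (440 - j) * (j + 1) := mul_nonneg (by omega) (by omega)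
  have hk2 : 0 ≤ (440 - j) * (j - 343) := mul_nonneg (by omega) (by omega)
  nlinarith [hdiv, hk1, hk2, hc, hrin, hX]

/-- **HEX `k = 10`, middle range: the hull-cell engine's `hcell` at `p = 7` (`v = 10`), odd `481 ≤ l ≤ 881`, top label; the sharp class forces `A = 3`.** [folklore] -/
theorem RefBand.cells_hex10_mid {l : ℕ} (hlo : 481 ≤ l) (hhi : l ≤ 881) (hodd : Odd l) {i : ℕ} (hi : i + 1 = (l - 1) / 2)
    (A : ℕ) (hA30 : A ∣ 30) (hA15 : 15 ∣ A * 10) (hAev : Even 10 → A ∣ 15) (hA3 : 3 ∣ 10 → A ∣ 10) (hA5 : 5 ∣ 10 → A ∣ 6) :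
    ∃ a₀ : ℕ, (∀ s : ℕ, s < a₀ → (1 : ℤ) * ((7 : ℕ) : ℤ) ^ s * (((7 : ℕ) : ℤ) - 1) < ((A * l : ℕ) : ℤ)) ∧
      ((A * l : ℕ) : ℤ) ≤ 1 * ((7 : ℕ) : ℤ) ^ a₀ * (((7 : ℕ) : ℤ) - 1) ∧
      ¬ HullCell ((A * l : ℕ) : ℤ) ((A * 10 : ℕ) : ℤ) ((i : ℤ) + 1) (((A * l) / ((7 : ℕ) - 1) + 1 : ℕ) : ℤ)
        (((7 : ℕ) : ℤ) ^ a₀ - (a₀ : ℤ) * ((A * l : ℕ) : ℤ)) := by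
  have hA31 : A ≤ 30 := Nat.le_of_dvd (by norm_num) hA30
  have hcl1 : A ∣ 15 := hAev (by decide)
  have hcl3 : A ∣ 6 := hA5 (by decide)
  have hA : A = 3 := by
    interval_cases A <;> first | rfl | (exfalso; revert hA30 hA15 hcl1 hcl3; decide)
  obtain ⟨j, hj⟩ := hodd
  have hij : (i : ℤ) + 1 = (j : ℤ) := by
    have : i + 1 = j := by omega
    exact_mod_cast this
  rcases hA with rfl
  have hrin : (6 : ℤ) * (((((3 * l) / ((7 : ℕ) - 1) + 1 : ℕ) : ℤ))) ≤ 3 * (2 * (j : ℤ) + 1) + 6 := by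
    have h0 : ((7 : ℕ) - 1) * ((3 * l) / ((7 : ℕ) - 1)) ≤ 3 * l := Nat.mul_div_le _ _
    have h1 : (6 : ℤ) * ((((3 * l) / ((7 : ℕ) - 1) : ℕ) : ℤ)) ≤ ((3 * l : ℕ) : ℤ) := by exact_mod_cast h0
    push_cast at h1 ⊢; omega
  have he : ((3 * l : ℕ) : ℤ) = 3 * (2 * (j : ℤ) + 1) := by push_cast; omega
  have hm : ((3 * 10 : ℕ) : ℤ) = 30 := by norm_num
  by_cases hp0 : 481 ≤ l ∧ l ≤ 685
  · refine ⟨3, fun s hs => ?_, ?_, ?_⟩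
    · interval_cases s <;> norm_num <;> omega
    · norm_num; omega
    · have hro : (((7 : ℕ) : ℤ) ^ 3 - ((3 : ℕ) : ℤ) * ((3 * l : ℕ) : ℤ)) = 343 - 3 * (3 * (2 * (j : ℤ) + 1)) := by
        push_cast; omega
      rw [hro, hij, he, hm]
      exact RefBand.not_hullCell_hex10mid_A3_a3 (by omega) (by omega) hrin
  by_cases hp1 : 687 ≤ l ∧ l ≤ 881
  · refine ⟨4, fun s hs => ?_, ?_, ?_⟩
    · interval_cases s <;> norm_num <;> omega
    · norm_num; omega
    · have hro : (((7 : ℕ) : ℤ) ^ 4 - ((4 : ℕ) : ℤ) * ((3 * l : ℕ) : ℤ)) = 2401 - 4 * (3 * (2 * (j : ℤ) + 1)) := by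
        push_cast; omega
      rw [hro, hij, he, hm]
      exact RefBand.not_hullCell_hex10mid_A3_a4 (by omega) (by omega) hrin
  exfalso; omega

/-! ## HEX `k = 12`: member `A = 5`, `481 ≤ l ≤ 3361` -/

/-- Floor-free failure of the top-label cell, `k = 12`, member `A = 5` (`e = 5l`, `m = 60`), turning point `a₀ = 4` (`r_out = 2401 − 4·5l`),
every `240 ≤ j ≤ 1440` (`l = 2j + 1`), ANY inner radius with `6·r_in ≤ 5l + 6`: downward parabola in `j`, positive on the range. [folklore] -/
theorem RefBand.not_hullCell_hex12mid_A5_a4 {j rin : ℤ} (hlo : 240 ≤ j) (hhi : j ≤ 1440) (hrin : 6 * rin ≤ 5 * (2 * j + 1) + 6) :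
    ¬ HullCell (5 * (2 * j + 1)) 60 j rin (2401 - 4 * (5 * (2 * j + 1))) := by
  intro hc
  unfold HullCell at hc
  set e : ℤ := 5 * (2 * j + 1) with he
  have he0 : 0 < e := by rw [he]; omega
  set X : ℤ := j ^ 2 * 60 - j * (e - 1) - (j + 1) * rin with hX
  have hdiv : X - e < e * (X / e) := by
    have h1 := Int.emod_add_mul_ediv X e
    have h2 := Int.emod_lt_of_pos X he0
    have h3 := Int.emod_nonneg X he0.ne'
    nlinarith [h1, h2, h3]
  have hk1 : 0 ≤ (1440 - j) * (j + 1) := mul_nonneg (by omega) (by omega)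
  have hk2 : 0 ≤ (1440 - j) * (j - 240) := mul_nonneg (by omega) (by omega)
  nlinarith [hdiv, hk1, hk2, hc, hrin, hX]

/-- Floor-free failure of the top-label cell, `k = 12`, member `A = 5` (`e = 5l`, `m = 60`), turning point `a₀ = 5` (`r_out = 16807 − 5·5l`),
every `1441 ≤ j ≤ 1680` (`l = 2j + 1`), ANY inner radius with `6·r_in ≤ 5l + 6`: downward parabola in `j`, positive on the range. [folklore] -/
theorem RefBand.not_hullCell_hex12mid_A5_a5 {j rin : ℤ} (hlo : 1441 ≤ j) (hhi : j ≤ 1680) (hrin : 6 * rin ≤ 5 * (2 * j + 1) + 6) :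
    ¬ HullCell (5 * (2 * j + 1)) 60 j rin (16807 - 5 * (5 * (2 * j + 1))) := by
  intro hc
  unfold HullCell at hc
  set e : ℤ := 5 * (2 * j + 1) with he
  have he0 : 0 < e := by rw [he]; omega
  set X : ℤ := j ^ 2 * 60 - j * (e - 1) - (j + 1) * rin with hX
  have hdiv : X - e < e * (X / e) := by
    have h1 := Int.emod_add_mul_ediv X e
    have h2 := Int.emod_lt_of_pos X he0
    have h3 := Int.emod_nonneg X he0.ne'
    nlinarith [h1, h2, h3]
  have hk1 : 0 ≤ (1680 - j) * (j + 1) := mul_nonneg (by omega) (by omega)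
  have hk2 : 0 ≤ (1680 - j) * (j - 1441) := mul_nonneg (by omega) (by omega)
  nlinarith [hdiv, hk1, hk2, hc, hrin, hX]

/-- **HEX `k = 12`, middle range: the hull-cell engine's `hcell` at `p = 7` (`v = 12`), odd `481 ≤ l ≤ 3361`, top label; the sharp class forces `A = 5`.** [folklore] -/
theorem RefBand.cells_hex12_mid {l : ℕ} (hlo : 481 ≤ l) (hhi : l ≤ 3361) (hodd : Odd l) {i : ℕ} (hi : i + 1 = (l - 1) / 2)
    (A : ℕ) (hA30 : A ∣ 30) (hA15 : 15 ∣ A * 12) (hAev : Even 12 → A ∣ 15) (hA3 : 3 ∣ 12 → A ∣ 10) (hA5 : 5 ∣ 12 → A ∣ 6) :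
    ∃ a₀ : ℕ, (∀ s : ℕ, s < a₀ → (1 : ℤ) * ((7 : ℕ) : ℤ) ^ s * (((7 : ℕ) : ℤ) - 1) < ((A * l : ℕ) : ℤ)) ∧
      ((A * l : ℕ) : ℤ) ≤ 1 * ((7 : ℕ) : ℤ) ^ a₀ * (((7 : ℕ) : ℤ) - 1) ∧
      ¬ HullCell ((A * l : ℕ) : ℤ) ((A * 12 : ℕ) : ℤ) ((i : ℤ) + 1) (((A * l) / ((7 : ℕ) - 1) + 1 : ℕ) : ℤ)
        (((7 : ℕ) : ℤ) ^ a₀ - (a₀ : ℤ) * ((A * l : ℕ) : ℤ)) := by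
  have hA31 : A ≤ 30 := Nat.le_of_dvd (by norm_num) hA30
  have hcl1 : A ∣ 15 := hAev (by decide)
  have hcl2 : A ∣ 10 := hA3 (by decide)
  have hA : A = 5 := by
    interval_cases A <;> first | rfl | (exfalso; revert hA30 hA15 hcl1 hcl2; decide)
  obtain ⟨j, hj⟩ := hodd
  have hij : (i : ℤ) + 1 = (j : ℤ) := by
    have : i + 1 = j := by omega
    exact_mod_cast this
  rcases hA with rfl
  have hrin : (6 : ℤ) * (((((5 * l) / ((7 : ℕ) - 1) + 1 : ℕ) : ℤ))) ≤ 5 * (2 * (j : ℤ) + 1) + 6 := by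
    have h0 : ((7 : ℕ) - 1) * ((5 * l) / ((7 : ℕ) - 1)) ≤ 5 * l := Nat.mul_div_le _ _
    have h1 : (6 : ℤ) * ((((5 * l) / ((7 : ℕ) - 1) : ℕ) : ℤ)) ≤ ((5 * l : ℕ) : ℤ) := by exact_mod_cast h0
    push_cast at h1 ⊢; omega
  have he : ((5 * l : ℕ) : ℤ) = 5 * (2 * (j : ℤ) + 1) := by push_cast; omega
  have hm : ((5 * 12 : ℕ) : ℤ) = 60 := by norm_num
  by_cases hp0 : 481 ≤ l ∧ l ≤ 2881
  · refine ⟨4, fun s hs => ?_, ?_, ?_⟩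
    · interval_cases s <;> norm_num <;> omega
    · norm_num; omega
    · have hro : (((7 : ℕ) : ℤ) ^ 4 - ((4 : ℕ) : ℤ) * ((5 * l : ℕ) : ℤ)) = 2401 - 4 * (5 * (2 * (j : ℤ) + 1)) := by
        push_cast; omega
      rw [hro, hij, he, hm]
      exact RefBand.not_hullCell_hex12mid_A5_a4 (by omega) (by omega) hrin
  by_cases hp1 : 2883 ≤ l ∧ l ≤ 3361
  · refine ⟨5, fun s hs => ?_, ?_, ?_⟩
    · interval_cases s <;> norm_num <;> omega
    · norm_num; omega
    · have hro : (((7 : ℕ) : ℤ) ^ 5 - ((5 : ℕ) : ℤ) * ((5 * l : ℕ) : ℤ)) = 16807 - 5 * (5 * (2 * (j : ℤ) + 1)) := by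
        push_cast; omega
      rw [hro, hij, he, hm]
      exact RefBand.not_hullCell_hex12mid_A5_a5 (by omega) (by omega) hrin
  exfalso; omega

end Summit.ABC.IUTFork.Conditional

end
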